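import Summits.QuantumFields.YangMills.Theorems.BalabanUVNodesK0TwoPrimeOfCofinalBoxes

/-!
# K0⁷ — DIRECTOR-YM №432's SINGLE-RADIUS NODE IN THE WEAKEST K0⁷-SUFFICIENT CURRENCY: the doors (α_cof) ∕ (κ_cof) of record
# ⟸ NODE O's letter (box, resp. 2-comparability of consecutive couplings) for `β₁₃(F; ā, ε₂₉)` at ONE FIXED RADIUS `ā` ALONG A COFINAL FAMILY OF (2.9)-THRESHOLDS + N07's standard slots;
# the (8)-row beyond Theorem 1's ceiling and the upward selector case of the 2′ door DROP OUT (only DOWNWARD radius blindness is used)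

Cell `pub-ymgap`, width seat `pub-ymgap-dag-n07-w3` (g21; N07 [B11] ∕ K0⁷ junction).  `--kind proof --supports stmt-QuantumFields-20541 --as helper`, COUNT-NEUTRAL.  NEW leaf; theorems
only — 0 `def`, 0 `sorry`, 0 `instance`, 0 `notation`.  Imports ONLY this seat's g20 file 4 `…K0TwoPrimeOfCofinalBoxes` (✓p793022; through it files 1–3 and g19's radius blindness
`…K0Beta13RadiusBlind{,FirstForm}`) — route-independent (no Theses cone).  The conclusions are the `F`-clauses of ym-nodeO DEF-1's doors (α_cof) `K0V23Stub3DoorSuppliers.K0BoxCofinalRadii` and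
(κ_cof) `…K0CompCofinalRadii` SPELLED INLINE (token-equal to their bodies), so that DEF-1's by-name closers `record13SepCoPHInhabited_of_k0BoxCofinalRadii` ∕ `…_of_k0CompCofinalRadii` compose
on them in one line (not typed here: that leaf sits in the Theses cone).  [I] = [Balaban1987RG1]; [15] = [Balaban1985Variational]; [III] = [Balaban1988Convergent]; [B7] = [Balaban1985Averaging].

WHY.  Director-ym №432 reshaped NODE O for seat -3 as «2′ ⟸ (W₁) ∧ (T)»: the REGISTERED stub text 2′ (`K0V23Defs.AbsBetaBoxAtThm1WitnessCCMGenGridGZBAt F`, a |β|-box at EVERY text radius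
`a₀ > 0`) from boxes at ONE fixed radius `ā` plus radius-blindness rows; g19∕g20 of this seat built that door (`…K0TwoPrimeOfCofinalBoxes.absBetaBoxGZBAt_of_cofinalBoxes`).  Because 2′ quantifies
over ALL radii, the door must move the letter UPWARD as well (`ā ≤ a₀ ≤ α₀` inside Theorem 1's window, and the displayed (8)-row `hceil` at text radii beyond the ceiling `α₀` — «nobody's
theorem»).  But K0⁷ itself does not need 2′: DEF-1's doors leaf shows `Record13SepCoPHInhabited` ⟸ (α_cof) «a box at SOME radius below every ceiling» ⟸ (κ_cof) «2-comparability of consecutive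
couplings along every in-window solution of (0.20), at ONE member, at SOME radius below every ceiling» (stub 1ᴮ's token is antitone in the radius).  Feeding THOSE doors from a single radius `ā`
needs the letter only at radii `min a ā ≤ ā` — DOWNWARD radius blindness, which g19 proved FREE of (8)-rows (`betaOfRecord₁₃_thm1CCMWZB_radiusBlind_firstForm_down`: every radius-`ā`
minimiser is `ρ`-regular with `ρ ≤ a₀`, so the radius-`a₀` selector returns the same configuration).  THIS FILE is that composition:
* §1 ★ `betaZB_eq_down_of_slots` — the β-identity `β₁₃(F; ā, ε₂₉) = β₁₃(F; a₀, ε₂₉)` for `ρ ≤ a₀ ≤ ā` in the FINAL slot currency of files 1–4 (door level: `ā < α₀` strictly, Berge's window at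
  `α`, threshold `0 < δ₁₁ ≤ α₁` with `B·δ₁₁ ≤ ā`, the four N07 slots `hT1 ∕ hUk ∕ h11 ∕ hLip`; per threshold `ε₂₉`: the regularity letter `ρ` with its numerics, the rider∕collar numerics, the
  continuity row (hT) on the plaquette ball) — the identity files 2–4 derive INSIDE their proofs, exported (read-set induction on the membership domain of record with `ε₀ := δ₁₁`; (I) from
  the slots at the ceiling, file 3 §2b; the collar row from `hLip`, file 3 §2; selector agreement DOWNWARD only, file 2's `Uk_eq_of_mem_domU_of_le`).
* §2 ★★ `k0CompCofinalRadii_clause_of_compAtFixedRadius` — the `F`-clause of DEF-1's door (κ_cof) from: the nine door-level numerics rows of file 4 on `(ā, εmax)`, the four slots, the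
  continuity row for every `ε₂₉ ≤ εmax`, and the producer's ONE-RADIUS COMPARABILITY LETTER (W₁ᶜ) «for every `0 < ε₂₉ ≤ εmax` SOME `γ₀ > 0` such that along every solution of (0.20) for
  `β₁₃(F; ā, ε₂₉)` staying in `]0, γ₀]` consecutive couplings are 2-comparable» (WEAKER than a box: `K0V23Stub3ComparabilitySuppliers.exists_twoComparable_of_runAbsBound`); per ceiling `a` the
  radius is `a₀ := min a ā`, the threshold `ε₂₉ := min εmax (a₀∕c)`, `ρ := c·ε₂₉`, `c := 80·B_L·L⁴ + 1` (file 4's absorption of the per-radius numerics, verbatim);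
  ★★ `k0BoxCofinalRadii_clause_of_boxAtFixedRadius` — the same for door (α_cof) from file 4's box producer (W₁) `hbox` (boxes at `ā` for every `ε₂₉ ≤ εmax`).
* COMPOSITION FOR K0⁷ (one line each, in the Theses cone, NOT typed here): `K0V23Stub3DoorSuppliers.record13SepCoPHInhabited_of_k0CompCofinalRadii (fun F => k0CompCofinalRadii_clause_of_compAtFixedRadius F …)`
  resp. `…_of_k0BoxCofinalRadii (fun F => k0BoxCofinalRadii_clause_of_boxAtFixedRadius F …)` — K0⁷'s decl BY NAME once every family carries such a single-radius package.  CONDITIONAL.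
WHAT DROPS OUT versus file 4's bill: `hceil` (the (8)-row at text radii `a₀ > α₀`) and the upward case — nothing is owed above `ā`; and in §2∕§3-comp the box weakens to comparability.  What
STAYS displayed: the slots `hT1` (Theorem 1 at objects), `hUk` (₈a rows, radii `[ā, α₀]`), `h11` ((1.1) on `PlaqSmall δ₁₁`, radii `[ā, α₀]`), `hLip` ([15] Prop. 9 species) — levels `k ≥ 1` =
Bałaban's theorems, proved NOWHERE in the tree (g20's LOCATED D-defB-1 and the S1c level guard stand); the continuity row (hT); and the one-radius NODE O letter — the wall, read along runs.
A6: the numerics windows are inhabited ranges by file 2's `openNumerics_inhabited` (`α`), file 1's `slotNumerics_inhabited` and file 4's `cofinalNumerics_inhabited` (`εmax`) — not repeated.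

HONEST FRAMING (binding).  By-name composition + real arithmetic; NO β estimate; nothing of Bałaban's asserted or discharged; the comparability ∕ box letter at `ā` is NODE O's wall
([I] Thm 3 β-clause p. 264 «uniformly bounded» STATED, proof unpublished [Balaban1989LargeFieldII] p. 355; [III] (2.6)–(2.8) ASSUMED in print) — inhabited nowhere; this file does NOT close
the registered stub 3ᴬ′ᴮ (2′) and closes K0⁷ only the day a producer delivers the one-radius letter AND the four slots; stub 2′ OPEN; K0⁷ stmt-QuantumFields-20541 NOT closed; N07 NOT
discharged; COUNT 8∕28 · K 1∕4 UNMOVED; R4 = the CONDITIONAL finite-𝕋⁴ rung `BalabanLadder.UV` at fixed `ε = L^(−K)` only — NOT continuum ∕ ℝ⁴ ∕ OS; the Yang–Mills mass gap (Clay) is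
NOT proved by any of this.  Standard axioms only.
-/

noncomputable section

open MeasureTheory Set Filter Topology
open scoped Matrix.Norms.L2Operator

namespace Summit.QuantumFields.YangMills.BalabanUVNodes.K0CompCofinalRadiiOfFixedRadius

open Literature.MathematicalPhysics.QuantumFieldTheory.Balaban1983to89
open Literature.MathematicalPhysics.QuantumFieldTheory.Balaban1983to89.Node00
open Literature.MathematicalPhysics.QuantumFieldTheory.Balaban1983to89.T4Continuum
open Literature.MathematicalPhysics.QuantumFieldTheory.Balaban1983to89.FlowStep
open Literature.MathematicalPhysics.QuantumFieldTheory.Balaban1983to89.B15DeterminingSets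
open Literature.MathematicalPhysics.QuantumFieldTheory.Balaban1983to89.ExpMeanLog (deltaSU deltaSU_pos)
open Literature.MathematicalPhysics.QuantumFieldTheory.Balaban1983to89.B12GaugeOrbits021 (OrbitRel)
open B12Eq019ActionBody (integrand)
open Summit.QuantumFields.YangMills.BalabanUVNodes.K0Beta13RadiusBlind (betaOfRecord₁₃_thm1CCMWZB_radiusBlind_of_readSet)
open Summit.QuantumFields.YangMills.BalabanUVNodes.K0TwoPrimeOfMembershipDomain (firstForm_of_mem_domU mem_domU_of_firstForm one_mem_domU isOpen_domU_of_slots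
  iter_Uk_mem_domU Uk_eq_of_mem_domU_of_le)
open Summit.QuantumFields.YangMills.BalabanUVNodes.K0TwoPrimeOfLipschitzCollar (chiFix29OfRecord_congr_εreg firstForm_of_chiFix29_of_lipschitz interior_of_slots)

/-! ## §1  The β-identity DOWNWARD in the final slot currency (files 1–4's internal step, exported) -/

section Identity

variable (F : T4Family)

/-- ★ **DOWNWARD RADIUS BLINDNESS IN N07's SLOT CURRENCY.**  Door level: radius `0 < ā < α₀` with `ā < α` in Berge's window ([B7] (53) pair at `α` and the two loop guards); threshold
`0 < δ₁₁ ≤ α₁`, `B·δ₁₁ ≤ ā`, `0 ≤ B`; the four N07 slots `hT1` (Theorem 1 at objects, every member), `hUk` (₈a rows, radii `[ā, α₀]`), `h11` ((1.1) existence ∧ uniqueness on `PlaqSmall δ₁₁`,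
radii `[ā, α₀]`), `hLip` (Lipschitz stability of the first form at radius `ā`, constants `t_L, r_L, B_L`).  Per threshold `ε₂₉ ≥ 0`: a regularity letter `ρ > 0` with the (53) pair, `2ρ ≤ δ₁₁`,
`2ρ ≤ α₁`, `2Bρ ≤ ā`, the rider pair `1640·(12Lε₂₉ + 18ā)·L⁶ ≤ 1`, `13·(12Lε₂₉ + 18ā)·L³ < δ_{SU(2)}`, `60L⁴ε₂₉ ≤ t_L`, `ρ∕L² ≤ r_L`, the collar floor `ρ∕L² + B_L·60L⁴ε₂₉ ≤ ρ`, and the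
continuity row (hT) of the `ā`-member's β-densities on the plaquette ball.  THEN for every radius `a₀` with `ρ ≤ a₀ ≤ ā` the β of record at the zero members of radii `ā` and `a₀` COINCIDE:
`β₁₃(F; ā, ε₂₉) = β₁₃(F; a₀, ε₂₉)`.  Proof = file 2's read-set induction on `Û K k := domUOfRecord ⟨…, ε₀ := δ₁₁⟩ ā ρ K k` (in range; `univ` above `K`): openness from the slots with (I)
DERIVED at `ā < α₀` (file 3 §2b), `1 ∈ Û`, (hN) from the collar row which `hLip` + the rider supply (file 3 §2), (hB) from file 1's restriction∕uniqueness, and the selector agreement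
DOWNWARD (`Uk_eq_of_mem_domU_of_le`, no (8)-row).  CONDITIONAL on the displayed rows; NO β estimate; nothing of Bałaban's asserted.
[cite: Balaban1987RG1, (1.20)–(1.22) p.264, (1.1)–(1.2) p.260, p.259, (2.3) p.265, (2.9) p.266 and p.267; Balaban1985Variational, Thm 1 (6),(8)–(10) p.279, Prop. 7 p.299, Prop. 9 p.309; Balaban1985Averaging, Prop. 2 (53) p.26 (bookkeeping)] -/
theorem betaZB_eq_down_of_slots (ā δ₁₁ α₀ α₁ B α tL rL BL : ℝ) (hā : 0 < ā) (hāα₀ : ā < α₀) (hB : 0 ≤ B)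
    (hδ₁₁ : 0 < δ₁₁) (hδα₁ : δ₁₁ ≤ α₁) (hBδ : B * δ₁₁ ≤ ā)
    (hāα : ā < α) (hα3 : 143 * 256 * α ≤ 1 / 3) (hα2 : 2 * α ≤ 2 * deltaSU (Fin 2) / (8 * (F.L : ℝ)) ^ 2)
    (hα24 : 9 * (F.L : ℝ) ^ 2 * (2 * α) ≤ 1 / 24) (hαL : 157 * (9 * (F.L : ℝ) ^ 2 * (2 * α)) < ((F.L : ℝ) ^ 3)⁻¹)
    (hT1 : ∀ (K k : ℕ) (ε₁ : ℝ), 0 < ε₁ → ε₁ ≤ α₁ → ∀ V : GaugeField (F.P K) k (Node00.SU 2), PlaqSmall ε₁ V →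
      (∃ U : GaugeField (F.P K) 0 (Node00.SU 2), IsBackground (avOfRecord F 2 K) {U | InUkClassB11 F 2 K k (B * ε₁) U} k V U) ∧
      (∀ ε₀ : ℝ, B * ε₁ ≤ ε₀ → ε₀ ≤ α₀ → ∀ U U' : GaugeField (F.P K) 0 (Node00.SU 2),
          IsBackground (avOfRecord F 2 K) {U | InUkClassB11 F 2 K k (B * ε₁) U} k V U →
          IsBackground (avOfRecord F 2 K) {U | InUkClassB11 F 2 K k ε₀ U} k V U' → InUkClassB11 F 2 K k ε₀ U ∧ OrbitRel k U U'))
    (hUk : ∀ (K k : ℕ) (ε : ℝ), ā ≤ ε → ε ≤ α₀ → ∀ (V : GaugeField (F.P K) k (Node00.SU 2)) (δ : ℝ), 0 < δ → δ ≤ α₁ → B * δ ≤ ε → PlaqSmall δ V →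
      UkExists F 2 K k ε V ∧ InUkClassB11 F 2 K k ε (Uk F 2 K k ε V))
    (h11 : ∀ (K k : ℕ) (ε : ℝ), ā ≤ ε → ε ≤ α₀ → ∀ V : GaugeField (F.P K) k (Node00.SU 2), PlaqSmall δ₁₁ V → UkExists F 2 K k ε V ∧ UniqueUkOrbit F 2 K k ε V)
    (hLip : ∀ (K k : ℕ) (V V' : GaugeField (F.P K) k (Node00.SU 2)) (t r : ℝ), 0 ≤ t → t ≤ tL → 0 < r → r ≤ rL →
      (∀ b, dist1 ((V' b)⁻¹ * V b) ≤ t) →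
      (UkExists F 2 K k ā V' ∧ ∀ U₁, IsBackground (avOfRecord F 2 K) (bgReg F 2 K k ā) k V' U₁ → U₁ ∈ bgReg F 2 K k r) →
      (UkExists F 2 K k ā V ∧ ∀ U₁, IsBackground (avOfRecord F 2 K) (bgReg F 2 K k ā) k V U₁ → U₁ ∈ bgReg F 2 K k (r + BL * t)))
    {a₀ ρ ε₂₉ : ℝ} (hle : a₀ ≤ ā) (hρa : ρ ≤ a₀)
    (hρ : 0 < ρ) (h53a : 143 * 256 * ρ ≤ 1 / 3) (h53b : 2 * ρ ≤ 2 * deltaSU (Fin 2) / (8 * (F.L : ℝ)) ^ 2)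
    (hδ : 2 * ρ ≤ δ₁₁) (hα₁ : 2 * ρ ≤ α₁) (hBρ : 2 * B * ρ ≤ ā) (hε29 : 0 ≤ ε₂₉)
    (hn1 : 1640 * (12 * (F.L : ℝ) * ε₂₉ + 18 * ā) * (F.L : ℝ) ^ 6 ≤ 1) (hn2 : 13 * (12 * (F.L : ℝ) * ε₂₉ + 18 * ā) * (F.L : ℝ) ^ 3 < deltaSU (Fin 2))
    (htL : 60 * (F.L : ℝ) ^ 4 * ε₂₉ ≤ tL) (hrL : ρ / (F.L : ℝ) ^ 2 ≤ rL) (hLρ : ρ / (F.L : ℝ) ^ 2 + BL * (60 * (F.L : ℝ) ^ 4 * ε₂₉) ≤ ρ)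
    (hT : ∀ K (g : ℕ → ℝ) k, k < K → {V : GaugeField (F.P K) (k + 1) (Node00.SU 2) | PlaqSmall δ₁₁ V} ⊆ regSetOfRecord F 2 K k
      (integrand (chiFixed29 F 2 (numerics7OfThm1CCM F.L 0 0 0 0 ā 0) ε₂₉ K g k) (gfOfRecord F 2 K k) (g k)
        (effActionHT F 2 (TcanOfRecord F 2) (chiFixed29 F 2 (numerics7OfThm1CCM F.L 0 0 0 0 ā 0) ε₂₉) K g k))) :
    betaOfRecord₁₃ F 2 (theta13OfThm1CCMWZB F 2 0 (1 / 2) ā 0 ε₂₉ 0 0 ā 0 (fun _ _ => 0) (fun _ _ => 0)) =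
      betaOfRecord₁₃ F 2 (theta13OfThm1CCMWZB F 2 0 (1 / 2) a₀ 0 ε₂₉ 0 0 a₀ 0 (fun _ _ => 0) (fun _ _ => 0)) := by
  have hā53a : 143 * 256 * ā ≤ 1 / 3 := by nlinarith
  have hā53b : 2 * ā ≤ 2 * deltaSU (Fin 2) / (8 * (F.L : ℝ)) ^ 2 := by linarith
  have hα : 0 < α := hā.trans hāα
  -- a threshold carrier whose `ε₀` is `δ₁₁` (no other field is read by `domUOfRecord`)
  obtain ⟨ν₁, hν⟩ : ∃ ν₁ : Stage7Numerics, ν₁.ε₀ = δ₁₁ :=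
    ⟨{ M₁ := 0, M₂ := 0, r := 0, p₀ := 0, A₀ := 0, logσ₀ := 0, εreg := 0, ε₀ := δ₁₁ }, rfl⟩
  have hδν : 2 * ρ ≤ ν₁.ε₀ := hν ▸ hδ
  -- the slots at the fixed radius `ā`, on the threshold ball of `ν₁`
  have h11ν : ∀ (K k : ℕ) (V : GaugeField (F.P K) k (Node00.SU 2)), PlaqSmall ν₁.ε₀ V → UkExists F 2 K k ā V ∧ UniqueUkOrbit F 2 K k ā V := by
    rw [hν]; exact fun K k => h11 K k ā le_rfl hāα₀.le
  have hUkā : ∀ (K k : ℕ) (V : GaugeField (F.P K) k (Node00.SU 2)) (δ : ℝ), 0 < δ → δ ≤ α₁ → B * δ ≤ ā → PlaqSmall δ V →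
      UkExists F 2 K k ā V ∧ InUkClassB11 F 2 K k ā (Uk F 2 K k ā V) := fun K k => hUk K k ā le_rfl hāα₀.le
  -- (I) at the door's radius from the slots at the ceiling `α₀ > ā` (file 3 §2b)
  have hIν : ∀ (K k : ℕ) (V : GaugeField (F.P K) k (Node00.SU 2)), PlaqSmall ν₁.ε₀ V → ∀ U₀ : GaugeField (F.P K) 0 (Node00.SU 2),
      IsBackground (avOfRecord F 2 K) (closure (bgReg F 2 K k ā)) k V U₀ → U₀ ∈ bgReg F 2 K k ā := by
    rw [hν]
    exact fun K k V hV => interior_of_slots K k hāα₀ le_rfl hδ₁₁ hδα₁ hBδ (hT1 K k) (hUk K k α₀ hāα₀.le le_rfl) (h11 K k α₀ hāα₀.le le_rfl) hV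
  -- the statement's carrier and the `δ₁₁`-member's carrier have the same `εreg = ā`, hence the same cutoff
  have hχ : ∀ (K k : ℕ), chiFix29OfRecord F 2 (numerics7OfThm1CCM F.L 0 0 0 0 ā 0) ε₂₉ K k =
      chiFix29OfRecord F 2 (numerics7OfThm1CCM F.L 0 δ₁₁ 0 0 ā 0) ε₂₉ K k := fun K k => chiFix29OfRecord_congr_εreg rfl ε₂₉ K k
  -- the collar row (hS) from `hLip` + the rider + the slots (file 3 §2)
  have hS : ∀ K k V, k < K →
      (UkExists F 2 K (k + 1) ā ((avOfRecord F 2 K k).avg V) ∧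
        ∀ U₁, IsBackground (avOfRecord F 2 K) (bgReg F 2 K (k + 1) ā) (k + 1) ((avOfRecord F 2 K k).avg V) U₁ → U₁ ∈ bgReg F 2 K (k + 1) ρ) →
      chiFix29OfRecord F 2 (numerics7OfThm1CCM F.L 0 0 0 0 ā 0) ε₂₉ K k V ≠ 0 →
      UkExists F 2 K k ā V ∧ ∀ U₁, IsBackground (avOfRecord F 2 K) (bgReg F 2 K k ā) k V U₁ → U₁ ∈ bgReg F 2 K k ρ := by
    intro K k V hk hW hz
    rw [hχ] at hz
    exact firstForm_of_chiFix29_of_lipschitz K k hk hā hāα₀.le hB hā53a hā53b hρ h53a h53b hδ hα₁ hBρ hε29 hn1 hn2 htL hrL hLρ (hT1 K k)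
      (hUk K k ā le_rfl hāα₀.le) (fun j V hV => h11 K j ā le_rfl hāα₀.le V hV) (hLip K k) hW hz
  -- the domain system fed to the read-set induction: the membership domain in range, `univ` above `K`
  obtain ⟨Û, hÛ⟩ : ∃ Û : (K k : ℕ) → Set (GaugeField (F.P K) k (Node00.SU 2)),
      Û = fun K k => if k ≤ K then domUOfRecord F 2 ν₁ ā ρ K k else Set.univ := ⟨_, rfl⟩
  have hin : ∀ K k, k ≤ K → Û K k = domUOfRecord F 2 ν₁ ā ρ K k := fun K k hk => by rw [hÛ]; exact if_pos hk
  have hout : ∀ K k, ¬ k ≤ K → Û K k = Set.univ := fun K k hk => by rw [hÛ]; exact if_neg hk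
  have hUo : ∀ K k, IsOpen (Û K k) := by
    intro K k
    by_cases hk : k ≤ K
    · rw [hin K k hk]
      exact isOpen_domU_of_slots K k (hk.trans (Nat.le_add_left K F.m)) hāα hα hα3 hα2 hα24 hαL hρ h53a h53b hδν (hIν K k) fun V hV => (h11ν K k V hV).2
    · rw [hout K k hk]; exact isOpen_univ
  have hU1 : ∀ K k, (1 : GaugeField (F.P K) k (Node00.SU 2)) ∈ Û K k := by
    intro K k
    by_cases hk : k ≤ K
    · rw [hin K k hk]; exact one_mem_domU K k hā hρ h53a h53b hδν (h11ν K k)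
    · rw [hout K k hk]; exact Set.mem_univ _
  have hC : ∀ K (g : ℕ → ℝ) k, k < K → Û K (k + 1) ⊆ regSetOfRecord F 2 K k
      (integrand (chiFixed29 F 2 (numerics7OfThm1CCM F.L 0 0 0 0 ā 0) ε₂₉ K g k) (gfOfRecord F 2 K k) (g k)
        (effActionHT F 2 (TcanOfRecord F 2) (chiFixed29 F 2 (numerics7OfThm1CCM F.L 0 0 0 0 ā 0) ε₂₉) K g k)) := by
    intro K g k hk V hV
    rw [hin K (k + 1) hk] at hV
    exact hT K g k hk (hν ▸ ((mem_domUOfRecord_iff ν₁ ā ρ K (k + 1) V).1 hV).1)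
  have hN : ∀ K k V, k < K → (avOfRecord F 2 K k).avg V ∈ Û K (k + 1) →
      chiFix29OfRecord F 2 (numerics7OfThm1CCM F.L 0 0 0 0 ā 0) ε₂₉ K k V ≠ 0 → V ∈ Û K k := by
    intro K k V hk hV hz
    rw [hin K (k + 1) hk] at hV
    rw [hin K k (Nat.le_of_lt hk)]
    exact mem_domU_of_firstForm hρ h53a h53b hδν (h11ν K k) (hS K k V hk (firstForm_of_mem_domU hV) hz)
  have hBr : ∀ K k W, k < K → W ∈ Û K (k + 1) → Averaging.iter (avOfRecord F 2 K) k (Uk F 2 K (k + 1) ā W) ∈ Û K k := by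
    intro K k W hk hW
    rw [hin K (k + 1) hk] at hW
    rw [hin K k (Nat.le_of_lt hk)]
    exact iter_Uk_mem_domU K k hā hāα₀.le hρ h53a h53b hδν hα₁ hB hBρ (hT1 K k) (hUkā K k) (h11ν K k) hW
  -- radius blindness ā ↦ a₀ at the zero member, on `Û`, selector agreement DOWNWARD only
  refine betaOfRecord₁₃_thm1CCMWZB_radiusBlind_of_readSet F 2 0 (1 / 2) 0 ε₂₉ 0 0 0 ā a₀ _ _ Û hUo hU1 ?_ hC hN hBr
  intro K k W hk hW
  rw [hin K (k + 1) hk] at hW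
  exact Uk_eq_of_mem_domU_of_le hle hρa hW

end Identity

/-! ## §2  The doors (κ_cof) and (α_cof), `F`-clause, from NODE O's letter at ONE fixed radius along cofinal thresholds -/

section Doors

variable (F : T4Family)

/-- ★★ **DOOR (κ_cof)'s `F`-CLAUSE FROM 2-COMPARABILITY AT ONE FIXED RADIUS** (director-ym №432's node in the weakest K0⁷-sufficient currency).  DOOR LEVEL (= file 4's): radius
`0 < ā < α₀` with `ā < α` in Berge's window; threshold `0 < δ₁₁ ≤ α₁`, `B·δ₁₁ ≤ ā`; constants `B, B_L ≥ 0`, `t_L, r_L`; a threshold ceiling `εmax > 0` with the NINE smallness rows of file 4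
(writing `c := 80·B_L·L⁴ + 1`); N07's slots `hT1 ∕ hUk ∕ h11 ∕ hLip`; the continuity row `hT` for every `ε₂₉ ∈ (0, εmax]`.  PRODUCER (W₁ᶜ) `hcomp`: for EVERY `ε₂₉ ∈ (0, εmax]` SOME `γ₀ > 0`
such that along every solution of (0.20) for `β₁₃(F; ā, ε₂₉)` staying in `]0, γ₀]` up to `n`, consecutive couplings are 2-comparable both ways.  THEN the `F`-clause of DEF-1's door
`K0CompCofinalRadii`: for every ceiling `a > 0` the letter holds at the radius `a₀ := min a ā ≤ a`, threshold `ε₂₉ := min εmax (a₀∕c)`, some `γ₀`, at the zero member.  Proof: §1 at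
`(a₀, ρ := c·ε₂₉, ε₂₉)` — the thirteen per-threshold rows follow from the nine door-level ones exactly as in file 4 — then transport of the comparability letter along the β-identity.  NO
upward row, NO (8)-row beyond the ceiling.  CONDITIONAL on every displayed row; NO β estimate; nothing of Bałaban's asserted.
[cite: Balaban1987RG1, Thm 3 p.264, §1 p.264, (0.20) p.256, (1.20)–(1.22) p.264, (1.1)–(1.2) p.260, (2.9) p.266 and p.267; Balaban1988Convergent, (2.6)–(2.8) pp.255–256; Balaban1985Variational, Thm 1 (6),(8)–(10) p.279, Prop. 9 p.309; Balaban1985Averaging, Prop. 2 (53) p.26 (bookkeeping)] -/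
theorem k0CompCofinalRadii_clause_of_compAtFixedRadius (ā δ₁₁ α₀ α₁ B α tL rL BL εmax : ℝ) (hā : 0 < ā) (hāα₀ : ā < α₀) (hB : 0 ≤ B) (hBL : 0 ≤ BL)
    (hδ₁₁ : 0 < δ₁₁) (hδα₁ : δ₁₁ ≤ α₁) (hBδ : B * δ₁₁ ≤ ā)
    (hāα : ā < α) (hα3 : 143 * 256 * α ≤ 1 / 3) (hα2 : 2 * α ≤ 2 * deltaSU (Fin 2) / (8 * (F.L : ℝ)) ^ 2)
    (hα24 : 9 * (F.L : ℝ) ^ 2 * (2 * α) ≤ 1 / 24) (hαL : 157 * (9 * (F.L : ℝ) ^ 2 * (2 * α)) < ((F.L : ℝ) ^ 3)⁻¹)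
    (hεmax : 0 < εmax)
    (hε53a : 143 * 256 * ((80 * BL * (F.L : ℝ) ^ 4 + 1) * εmax) ≤ 1 / 3)
    (hε53b : 2 * ((80 * BL * (F.L : ℝ) ^ 4 + 1) * εmax) ≤ 2 * deltaSU (Fin 2) / (8 * (F.L : ℝ)) ^ 2)
    (hεδ : 2 * ((80 * BL * (F.L : ℝ) ^ 4 + 1) * εmax) ≤ δ₁₁) (hεα₁ : 2 * ((80 * BL * (F.L : ℝ) ^ 4 + 1) * εmax) ≤ α₁)
    (hεB : 2 * B * ((80 * BL * (F.L : ℝ) ^ 4 + 1) * εmax) ≤ ā)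
    (hεn1 : 1640 * (12 * (F.L : ℝ) * εmax + 18 * ā) * (F.L : ℝ) ^ 6 ≤ 1) (hεn2 : 13 * (12 * (F.L : ℝ) * εmax + 18 * ā) * (F.L : ℝ) ^ 3 < deltaSU (Fin 2))
    (hεtL : 60 * (F.L : ℝ) ^ 4 * εmax ≤ tL) (hεrL : (80 * BL * (F.L : ℝ) ^ 4 + 1) * εmax / (F.L : ℝ) ^ 2 ≤ rL)
    (hT1 : ∀ (K k : ℕ) (ε₁ : ℝ), 0 < ε₁ → ε₁ ≤ α₁ → ∀ V : GaugeField (F.P K) k (Node00.SU 2), PlaqSmall ε₁ V →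
      (∃ U : GaugeField (F.P K) 0 (Node00.SU 2), IsBackground (avOfRecord F 2 K) {U | InUkClassB11 F 2 K k (B * ε₁) U} k V U) ∧
      (∀ ε₀ : ℝ, B * ε₁ ≤ ε₀ → ε₀ ≤ α₀ → ∀ U U' : GaugeField (F.P K) 0 (Node00.SU 2),
          IsBackground (avOfRecord F 2 K) {U | InUkClassB11 F 2 K k (B * ε₁) U} k V U →
          IsBackground (avOfRecord F 2 K) {U | InUkClassB11 F 2 K k ε₀ U} k V U' → InUkClassB11 F 2 K k ε₀ U ∧ OrbitRel k U U'))
    (hUk : ∀ (K k : ℕ) (ε : ℝ), ā ≤ ε → ε ≤ α₀ → ∀ (V : GaugeField (F.P K) k (Node00.SU 2)) (δ : ℝ), 0 < δ → δ ≤ α₁ → B * δ ≤ ε → PlaqSmall δ V →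
      UkExists F 2 K k ε V ∧ InUkClassB11 F 2 K k ε (Uk F 2 K k ε V))
    (h11 : ∀ (K k : ℕ) (ε : ℝ), ā ≤ ε → ε ≤ α₀ → ∀ V : GaugeField (F.P K) k (Node00.SU 2), PlaqSmall δ₁₁ V → UkExists F 2 K k ε V ∧ UniqueUkOrbit F 2 K k ε V)
    (hLip : ∀ (K k : ℕ) (V V' : GaugeField (F.P K) k (Node00.SU 2)) (t r : ℝ), 0 ≤ t → t ≤ tL → 0 < r → r ≤ rL →
      (∀ b, dist1 ((V' b)⁻¹ * V b) ≤ t) →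
      (UkExists F 2 K k ā V' ∧ ∀ U₁, IsBackground (avOfRecord F 2 K) (bgReg F 2 K k ā) k V' U₁ → U₁ ∈ bgReg F 2 K k r) →
      (UkExists F 2 K k ā V ∧ ∀ U₁, IsBackground (avOfRecord F 2 K) (bgReg F 2 K k ā) k V U₁ → U₁ ∈ bgReg F 2 K k (r + BL * t)))
    (hcomp : ∀ ε₂₉ : ℝ, 0 < ε₂₉ → ε₂₉ ≤ εmax → ∃ γ₀ : ℝ, 0 < γ₀ ∧
      ∀ (n : ℕ) (gs : ℕ → ℝ), RGEqH n (betaOfRecord₁₃ F 2 (theta13OfThm1CCMWZB F 2 0 (1 / 2) ā 0 ε₂₉ 0 0 ā 0 (fun _ _ => 0) (fun _ _ => 0))) gs →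
        Step.InInterval γ₀ n gs → ∀ m, m < n → gs m ≤ 2 * gs (m + 1) ∧ gs (m + 1) ≤ 2 * gs m)
    (hT : ∀ ε₂₉ : ℝ, 0 < ε₂₉ → ε₂₉ ≤ εmax → ∀ K (g : ℕ → ℝ) k, k < K →
      {V : GaugeField (F.P K) (k + 1) (Node00.SU 2) | PlaqSmall δ₁₁ V} ⊆ regSetOfRecord F 2 K k
        (integrand (chiFixed29 F 2 (numerics7OfThm1CCM F.L 0 0 0 0 ā 0) ε₂₉ K g k) (gfOfRecord F 2 K k) (g k)
          (effActionHT F 2 (TcanOfRecord F 2) (chiFixed29 F 2 (numerics7OfThm1CCM F.L 0 0 0 0 ā 0) ε₂₉) K g k))) :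
    ∀ a : ℝ, 0 < a → ∃ a₀ : ℝ, 0 < a₀ ∧ a₀ ≤ a ∧
      ∃ (γ₀ ε₂₉ : ℝ) (j : ℕ) (ε₀ B₃ B₃' a₁ : ℝ) (Efl logz : B12.RunParams → ℕ → ℝ), 0 < γ₀ ∧ 0 < ε₂₉ ∧
        ∀ (n : ℕ) (gs : ℕ → ℝ), RGEqH n (betaOfRecord₁₃ F 2 (theta13OfThm1CCMWZB F 2 j (1 / 2) a₀ ε₀ ε₂₉ B₃ B₃' a₀ a₁ Efl logz)) gs → Step.InInterval γ₀ n gs →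
          ∀ m, m < n → gs m ≤ 2 * gs (m + 1) ∧ gs (m + 1) ≤ 2 * gs m := by
  intro a ha
  have hL11 : (11 : ℝ) < (F.L : ℝ) := by exact_mod_cast F.hL11
  have hL0 : (0 : ℝ) < (F.L : ℝ) := by linarith
  have hL4 : (4 : ℝ) ≤ (F.L : ℝ) ^ 2 := by nlinarith
  -- the door's constant `c := 80·B_L·L⁴ + 1`
  obtain ⟨c, hc⟩ : ∃ c : ℝ, c = 80 * BL * (F.L : ℝ) ^ 4 + 1 := ⟨_, rfl⟩
  have hcpos : 0 < c := by rw [hc]; positivity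
  -- the radius below the ceiling, the threshold and the membership radius
  obtain ⟨a₀, ha₀⟩ : ∃ a₀ : ℝ, a₀ = min a ā := ⟨_, rfl⟩
  have ha₀pos : 0 < a₀ := by rw [ha₀]; exact lt_min ha hā
  have ha₀a : a₀ ≤ a := by rw [ha₀]; exact min_le_left _ _
  have ha₀ā : a₀ ≤ ā := by rw [ha₀]; exact min_le_right _ _
  obtain ⟨ε, hε⟩ : ∃ ε : ℝ, ε = min εmax (a₀ / c) := ⟨_, rfl⟩
  have hεpos : 0 < ε := by rw [hε]; exact lt_min hεmax (div_pos ha₀pos hcpos)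
  have hεle : ε ≤ εmax := by rw [hε]; exact min_le_left _ _
  have hεa₀ : ε ≤ a₀ / c := by rw [hε]; exact min_le_right _ _
  have hρle : c * ε ≤ c * εmax := mul_le_mul_of_nonneg_left hεle hcpos.le
  have hcε : c * εmax = (80 * BL * (F.L : ℝ) ^ 4 + 1) * εmax := by rw [hc]
  have hρa₀ : c * ε ≤ a₀ := by
    calc c * ε ≤ c * (a₀ / c) := mul_le_mul_of_nonneg_left hεa₀ hcpos.le
      _ = a₀ := mul_div_cancel₀ a₀ hcpos.ne'
  -- the thirteen per-threshold rows from the nine door-level ones (monotone in `ε₂₉`)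
  have h53a : 143 * 256 * (c * ε) ≤ 1 / 3 :=
    calc 143 * 256 * (c * ε) ≤ 143 * 256 * (c * εmax) := by gcongr
      _ ≤ 1 / 3 := by rw [hcε]; exact hε53a
  have h53b : 2 * (c * ε) ≤ 2 * deltaSU (Fin 2) / (8 * (F.L : ℝ)) ^ 2 :=
    calc 2 * (c * ε) ≤ 2 * (c * εmax) := by gcongr
      _ ≤ 2 * deltaSU (Fin 2) / (8 * (F.L : ℝ)) ^ 2 := by rw [hcε]; exact hε53b
  have hδ : 2 * (c * ε) ≤ δ₁₁ :=
    calc 2 * (c * ε) ≤ 2 * (c * εmax) := by gcongr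
      _ ≤ δ₁₁ := by rw [hcε]; exact hεδ
  have hα₁ : 2 * (c * ε) ≤ α₁ :=
    calc 2 * (c * ε) ≤ 2 * (c * εmax) := by gcongr
      _ ≤ α₁ := by rw [hcε]; exact hεα₁
  have hBρ : 2 * B * (c * ε) ≤ ā :=
    calc 2 * B * (c * ε) ≤ 2 * B * (c * εmax) := mul_le_mul_of_nonneg_left hρle (by positivity)
      _ ≤ ā := by rw [hcε]; exact hεB
  have hn1 : 1640 * (12 * (F.L : ℝ) * ε + 18 * ā) * (F.L : ℝ) ^ 6 ≤ 1 := by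
    have h : 1640 * (12 * (F.L : ℝ) * ε + 18 * ā) * (F.L : ℝ) ^ 6 ≤ 1640 * (12 * (F.L : ℝ) * εmax + 18 * ā) * (F.L : ℝ) ^ 6 := by gcongr
    exact h.trans hεn1
  have hn2 : 13 * (12 * (F.L : ℝ) * ε + 18 * ā) * (F.L : ℝ) ^ 3 < deltaSU (Fin 2) := by
    have h : 13 * (12 * (F.L : ℝ) * ε + 18 * ā) * (F.L : ℝ) ^ 3 ≤ 13 * (12 * (F.L : ℝ) * εmax + 18 * ā) * (F.L : ℝ) ^ 3 := by gcongr
    exact h.trans_lt hεn2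
  have htL : 60 * (F.L : ℝ) ^ 4 * ε ≤ tL :=
    calc 60 * (F.L : ℝ) ^ 4 * ε ≤ 60 * (F.L : ℝ) ^ 4 * εmax := by gcongr
      _ ≤ tL := hεtL
  have hrL : c * ε / (F.L : ℝ) ^ 2 ≤ rL :=
    calc c * ε / (F.L : ℝ) ^ 2 ≤ c * εmax / (F.L : ℝ) ^ 2 := by gcongr
      _ ≤ rL := by rw [hcε]; exact hεrL
  have hLρ : c * ε / (F.L : ℝ) ^ 2 + BL * (60 * (F.L : ℝ) ^ 4 * ε) ≤ c * ε := by
    -- the collar floor: `cε∕L² + B_L·60L⁴ε ≤ cε` because `L² ≥ 4` and `c = 80B_L L⁴ + 1`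
    have h1 : c * ε / (F.L : ℝ) ^ 2 ≤ c * ε / 4 := div_le_div_of_nonneg_left (by positivity) (by norm_num) hL4
    have h2 : BL * (60 * (F.L : ℝ) ^ 4 * ε) = 60 * (BL * (F.L : ℝ) ^ 4 * ε) := by ring
    have h3 : c * ε = 80 * (BL * (F.L : ℝ) ^ 4 * ε) + ε := by rw [hc]; ring
    have h4 : 0 ≤ BL * (F.L : ℝ) ^ 4 * ε := by positivity
    rw [h2]
    linarith
  -- the β-identity ā ↦ a₀ at the threshold `ε`
  have heq := betaZB_eq_down_of_slots F ā δ₁₁ α₀ α₁ B α tL rL BL hā hāα₀ hB hδ₁₁ hδα₁ hBδ hāα hα3 hα2 hα24 hαL hT1 hUk h11 hLip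
    ha₀ā hρa₀ (mul_pos hcpos hεpos) h53a h53b hδ hα₁ hBρ hεpos.le hn1 hn2 htL hrL hLρ (hT ε hεpos hεle)
  -- the producer's letter at `ā`, transported
  obtain ⟨γ₀, hγ₀, hC⟩ := hcomp ε hεpos hεle
  refine ⟨a₀, ha₀pos, ha₀a, γ₀, ε, 0, 0, 0, 0, 0, fun _ _ => 0, fun _ _ => 0, hγ₀, hεpos, ?_⟩
  rw [← heq]
  exact hC

/-- ★★ **DOOR (α_cof)'s `F`-CLAUSE FROM BOXES AT ONE FIXED RADIUS** — file 4's producer rows VERBATIM ((W₁) `hbox`: for every `ε₂₉ ∈ (0, εmax]` a box `−β′ ≤ β₁₃(F; ā, ε₂₉) ≤ β′` on some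
`]0, γ₀]` at the zero member; the continuity row `hT`; the nine door-level numerics; N07's four slots) WITHOUT the (8)-row `hceil`: the `F`-clause of DEF-1's door `K0BoxCofinalRadii` (a box at the
radius `min a ā` below every ceiling `a`).  Same proof as the comparability edition with the box transported along §1's identity.  CONDITIONAL on every displayed row; NO β estimate; nothing of
Bałaban's asserted. [cite: Balaban1987RG1, Thm 1 p.259, Thm 3 p.264, (1.20)–(1.22) p.264, (1.1)–(1.2) p.260, (2.9) p.266 and p.267; Balaban1985Variational, Thm 1 (6),(8)–(10) p.279, Prop. 9 p.309; Balaban1985Averaging, Prop. 2 (53) p.26 (bookkeeping)] -/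
theorem k0BoxCofinalRadii_clause_of_boxAtFixedRadius (ā δ₁₁ α₀ α₁ B α tL rL BL εmax : ℝ) (hā : 0 < ā) (hāα₀ : ā < α₀) (hB : 0 ≤ B) (hBL : 0 ≤ BL)
    (hδ₁₁ : 0 < δ₁₁) (hδα₁ : δ₁₁ ≤ α₁) (hBδ : B * δ₁₁ ≤ ā)
    (hāα : ā < α) (hα3 : 143 * 256 * α ≤ 1 / 3) (hα2 : 2 * α ≤ 2 * deltaSU (Fin 2) / (8 * (F.L : ℝ)) ^ 2)
    (hα24 : 9 * (F.L : ℝ) ^ 2 * (2 * α) ≤ 1 / 24) (hαL : 157 * (9 * (F.L : ℝ) ^ 2 * (2 * α)) < ((F.L : ℝ) ^ 3)⁻¹)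
    (hεmax : 0 < εmax)
    (hε53a : 143 * 256 * ((80 * BL * (F.L : ℝ) ^ 4 + 1) * εmax) ≤ 1 / 3)
    (hε53b : 2 * ((80 * BL * (F.L : ℝ) ^ 4 + 1) * εmax) ≤ 2 * deltaSU (Fin 2) / (8 * (F.L : ℝ)) ^ 2)
    (hεδ : 2 * ((80 * BL * (F.L : ℝ) ^ 4 + 1) * εmax) ≤ δ₁₁) (hεα₁ : 2 * ((80 * BL * (F.L : ℝ) ^ 4 + 1) * εmax) ≤ α₁)
    (hεB : 2 * B * ((80 * BL * (F.L : ℝ) ^ 4 + 1) * εmax) ≤ ā)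
    (hεn1 : 1640 * (12 * (F.L : ℝ) * εmax + 18 * ā) * (F.L : ℝ) ^ 6 ≤ 1) (hεn2 : 13 * (12 * (F.L : ℝ) * εmax + 18 * ā) * (F.L : ℝ) ^ 3 < deltaSU (Fin 2))
    (hεtL : 60 * (F.L : ℝ) ^ 4 * εmax ≤ tL) (hεrL : (80 * BL * (F.L : ℝ) ^ 4 + 1) * εmax / (F.L : ℝ) ^ 2 ≤ rL)
    (hT1 : ∀ (K k : ℕ) (ε₁ : ℝ), 0 < ε₁ → ε₁ ≤ α₁ → ∀ V : GaugeField (F.P K) k (Node00.SU 2), PlaqSmall ε₁ V →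
      (∃ U : GaugeField (F.P K) 0 (Node00.SU 2), IsBackground (avOfRecord F 2 K) {U | InUkClassB11 F 2 K k (B * ε₁) U} k V U) ∧
      (∀ ε₀ : ℝ, B * ε₁ ≤ ε₀ → ε₀ ≤ α₀ → ∀ U U' : GaugeField (F.P K) 0 (Node00.SU 2),
          IsBackground (avOfRecord F 2 K) {U | InUkClassB11 F 2 K k (B * ε₁) U} k V U →
          IsBackground (avOfRecord F 2 K) {U | InUkClassB11 F 2 K k ε₀ U} k V U' → InUkClassB11 F 2 K k ε₀ U ∧ OrbitRel k U U'))
    (hUk : ∀ (K k : ℕ) (ε : ℝ), ā ≤ ε → ε ≤ α₀ → ∀ (V : GaugeField (F.P K) k (Node00.SU 2)) (δ : ℝ), 0 < δ → δ ≤ α₁ → B * δ ≤ ε → PlaqSmall δ V →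
      UkExists F 2 K k ε V ∧ InUkClassB11 F 2 K k ε (Uk F 2 K k ε V))
    (h11 : ∀ (K k : ℕ) (ε : ℝ), ā ≤ ε → ε ≤ α₀ → ∀ V : GaugeField (F.P K) k (Node00.SU 2), PlaqSmall δ₁₁ V → UkExists F 2 K k ε V ∧ UniqueUkOrbit F 2 K k ε V)
    (hLip : ∀ (K k : ℕ) (V V' : GaugeField (F.P K) k (Node00.SU 2)) (t r : ℝ), 0 ≤ t → t ≤ tL → 0 < r → r ≤ rL →
      (∀ b, dist1 ((V' b)⁻¹ * V b) ≤ t) →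
      (UkExists F 2 K k ā V' ∧ ∀ U₁, IsBackground (avOfRecord F 2 K) (bgReg F 2 K k ā) k V' U₁ → U₁ ∈ bgReg F 2 K k r) →
      (UkExists F 2 K k ā V ∧ ∀ U₁, IsBackground (avOfRecord F 2 K) (bgReg F 2 K k ā) k V U₁ → U₁ ∈ bgReg F 2 K k (r + BL * t)))
    (hbox : ∀ ε₂₉ : ℝ, 0 < ε₂₉ → ε₂₉ ≤ εmax → ∃ γ₀ β' : ℝ, 0 < γ₀ ∧
      BetaLowerH (-β') γ₀ (betaOfRecord₁₃ F 2 (theta13OfThm1CCMWZB F 2 0 (1 / 2) ā 0 ε₂₉ 0 0 ā 0 (fun _ _ => 0) (fun _ _ => 0))) ∧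
      BetaUpperH β' γ₀ (betaOfRecord₁₃ F 2 (theta13OfThm1CCMWZB F 2 0 (1 / 2) ā 0 ε₂₉ 0 0 ā 0 (fun _ _ => 0) (fun _ _ => 0))))
    (hT : ∀ ε₂₉ : ℝ, 0 < ε₂₉ → ε₂₉ ≤ εmax → ∀ K (g : ℕ → ℝ) k, k < K →
      {V : GaugeField (F.P K) (k + 1) (Node00.SU 2) | PlaqSmall δ₁₁ V} ⊆ regSetOfRecord F 2 K k
        (integrand (chiFixed29 F 2 (numerics7OfThm1CCM F.L 0 0 0 0 ā 0) ε₂₉ K g k) (gfOfRecord F 2 K k) (g k)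
          (effActionHT F 2 (TcanOfRecord F 2) (chiFixed29 F 2 (numerics7OfThm1CCM F.L 0 0 0 0 ā 0) ε₂₉) K g k))) :
    ∀ a : ℝ, 0 < a → ∃ a₀ : ℝ, 0 < a₀ ∧ a₀ ≤ a ∧
      ∃ (γ₀ ε₂₉ β' : ℝ) (j : ℕ) (ε₀ B₃ B₃' a₁ : ℝ) (Efl logz : B12.RunParams → ℕ → ℝ), 0 < γ₀ ∧ 0 < ε₂₉ ∧
        BetaLowerH (-β') γ₀ (betaOfRecord₁₃ F 2 (theta13OfThm1CCMWZB F 2 j (1 / 2) a₀ ε₀ ε₂₉ B₃ B₃' a₀ a₁ Efl logz)) ∧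
        BetaUpperH β' γ₀ (betaOfRecord₁₃ F 2 (theta13OfThm1CCMWZB F 2 j (1 / 2) a₀ ε₀ ε₂₉ B₃ B₃' a₀ a₁ Efl logz)) := by
  intro a ha
  have hL11 : (11 : ℝ) < (F.L : ℝ) := by exact_mod_cast F.hL11
  have hL0 : (0 : ℝ) < (F.L : ℝ) := by linarith
  have hL4 : (4 : ℝ) ≤ (F.L : ℝ) ^ 2 := by nlinarith
  obtain ⟨c, hc⟩ : ∃ c : ℝ, c = 80 * BL * (F.L : ℝ) ^ 4 + 1 := ⟨_, rfl⟩
  have hcpos : 0 < c := by rw [hc]; positivity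
  obtain ⟨a₀, ha₀⟩ : ∃ a₀ : ℝ, a₀ = min a ā := ⟨_, rfl⟩
  have ha₀pos : 0 < a₀ := by rw [ha₀]; exact lt_min ha hā
  have ha₀a : a₀ ≤ a := by rw [ha₀]; exact min_le_left _ _
  have ha₀ā : a₀ ≤ ā := by rw [ha₀]; exact min_le_right _ _
  obtain ⟨ε, hε⟩ : ∃ ε : ℝ, ε = min εmax (a₀ / c) := ⟨_, rfl⟩
  have hεpos : 0 < ε := by rw [hε]; exact lt_min hεmax (div_pos ha₀pos hcpos)
  have hεle : ε ≤ εmax := by rw [hε]; exact min_le_left _ _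
  have hεa₀ : ε ≤ a₀ / c := by rw [hε]; exact min_le_right _ _
  have hρle : c * ε ≤ c * εmax := mul_le_mul_of_nonneg_left hεle hcpos.le
  have hcε : c * εmax = (80 * BL * (F.L : ℝ) ^ 4 + 1) * εmax := by rw [hc]
  have hρa₀ : c * ε ≤ a₀ := by
    calc c * ε ≤ c * (a₀ / c) := mul_le_mul_of_nonneg_left hεa₀ hcpos.le
      _ = a₀ := mul_div_cancel₀ a₀ hcpos.ne'
  have h53a : 143 * 256 * (c * ε) ≤ 1 / 3 :=
    calc 143 * 256 * (c * ε) ≤ 143 * 256 * (c * εmax) := by gcongr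
      _ ≤ 1 / 3 := by rw [hcε]; exact hε53a
  have h53b : 2 * (c * ε) ≤ 2 * deltaSU (Fin 2) / (8 * (F.L : ℝ)) ^ 2 :=
    calc 2 * (c * ε) ≤ 2 * (c * εmax) := by gcongr
      _ ≤ 2 * deltaSU (Fin 2) / (8 * (F.L : ℝ)) ^ 2 := by rw [hcε]; exact hε53b
  have hδ : 2 * (c * ε) ≤ δ₁₁ :=
    calc 2 * (c * ε) ≤ 2 * (c * εmax) := by gcongr
      _ ≤ δ₁₁ := by rw [hcε]; exact hεδ
  have hα₁ : 2 * (c * ε) ≤ α₁ :=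
    calc 2 * (c * ε) ≤ 2 * (c * εmax) := by gcongr
      _ ≤ α₁ := by rw [hcε]; exact hεα₁
  have hBρ : 2 * B * (c * ε) ≤ ā :=
    calc 2 * B * (c * ε) ≤ 2 * B * (c * εmax) := mul_le_mul_of_nonneg_left hρle (by positivity)
      _ ≤ ā := by rw [hcε]; exact hεB
  have hn1 : 1640 * (12 * (F.L : ℝ) * ε + 18 * ā) * (F.L : ℝ) ^ 6 ≤ 1 := by
    have h : 1640 * (12 * (F.L : ℝ) * ε + 18 * ā) * (F.L : ℝ) ^ 6 ≤ 1640 * (12 * (F.L : ℝ) * εmax + 18 * ā) * (F.L : ℝ) ^ 6 := by gcongr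
    exact h.trans hεn1
  have hn2 : 13 * (12 * (F.L : ℝ) * ε + 18 * ā) * (F.L : ℝ) ^ 3 < deltaSU (Fin 2) := by
    have h : 13 * (12 * (F.L : ℝ) * ε + 18 * ā) * (F.L : ℝ) ^ 3 ≤ 13 * (12 * (F.L : ℝ) * εmax + 18 * ā) * (F.L : ℝ) ^ 3 := by gcongr
    exact h.trans_lt hεn2
  have htL : 60 * (F.L : ℝ) ^ 4 * ε ≤ tL :=
    calc 60 * (F.L : ℝ) ^ 4 * ε ≤ 60 * (F.L : ℝ) ^ 4 * εmax := by gcongr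
      _ ≤ tL := hεtL
  have hrL : c * ε / (F.L : ℝ) ^ 2 ≤ rL :=
    calc c * ε / (F.L : ℝ) ^ 2 ≤ c * εmax / (F.L : ℝ) ^ 2 := by gcongr
      _ ≤ rL := by rw [hcε]; exact hεrL
  have hLρ : c * ε / (F.L : ℝ) ^ 2 + BL * (60 * (F.L : ℝ) ^ 4 * ε) ≤ c * ε := by
    have h1 : c * ε / (F.L : ℝ) ^ 2 ≤ c * ε / 4 := div_le_div_of_nonneg_left (by positivity) (by norm_num) hL4
    have h2 : BL * (60 * (F.L : ℝ) ^ 4 * ε) = 60 * (BL * (F.L : ℝ) ^ 4 * ε) := by ring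
    have h3 : c * ε = 80 * (BL * (F.L : ℝ) ^ 4 * ε) + ε := by rw [hc]; ring
    have h4 : 0 ≤ BL * (F.L : ℝ) ^ 4 * ε := by positivity
    rw [h2]
    linarith
  have heq := betaZB_eq_down_of_slots F ā δ₁₁ α₀ α₁ B α tL rL BL hā hāα₀ hB hδ₁₁ hδα₁ hBδ hāα hα3 hα2 hα24 hαL hT1 hUk h11 hLip
    ha₀ā hρa₀ (mul_pos hcpos hεpos) h53a h53b hδ hα₁ hBρ hεpos.le hn1 hn2 htL hrL hLρ (hT ε hεpos hεle)
  obtain ⟨γ₀, β', hγ₀, hlo, hup⟩ := hbox ε hεpos hεle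
  refine ⟨a₀, ha₀pos, ha₀a, γ₀, ε, β', 0, 0, 0, 0, 0, fun _ _ => 0, fun _ _ => 0, hγ₀, hεpos, ?_, ?_⟩
  · rw [← heq]; exact hlo
  · rw [← heq]; exact hup

end Doors

end Summit.QuantumFields.YangMills.BalabanUVNodes.K0CompCofinalRadiiOfFixedRadius
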